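import Summits.QuantumFields.BalabanUV.Beta.FP.TorusCombNestedBasis
import Summits.QuantumFields.BalabanUV.Beta.FP.ExponentialTransportJets

/-!
# `BalabanUV.Beta.FP.TorusGeneratorIntertwining` — road «FP» for binder row D1, ROUTE T, presentation T-β: **(T-β-4) AT ORDER 1 ON THE TORUS IS THE
# PRODUCT RULE — the gauge-mode span of the torus call is closed under multiplication by a site function, with an EXPLICIT block-triangular parameter
# transport; hence the intertwining letter `j1` of `NestedStepLawTorusTransported` holds EXACTLY with `W′₁ := W₁^{(h+Dλ)}`, and `uC` is automatic**

WHAT.  The OWNER d1-p3 g18's torus call «transport first» (`FP/NestedStepLawTorusTransported`, INTENT I-FP-18-2 (B), journal l.40233) displays the (T-β-4)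
letters `j1 : −X * fromCols D₂ D₁ + W₁ = W′₁ + fromCols D₂ D₁ * C₁`, `j2`, `uC : secondVar 1 C₁ C₂ = 0` (the transported nested-chart generator jets are the
one-shot chart's generator jets re-parametrised by a unimodular `C`).  leaf-02 g18 (`PeriodisedBorderIndexWard`, `torus_conj_first_averaging_word`) reads the
field transport at the record as the DIAGONAL shadow `X := −(c • diagonal (fun b => λ b.1))` («a field leg rotates at the BASE of its bond») for a torus site
function `λ`, and the generator first jet along a bond weight `w` as the row-ultralocal TIP contact `W₁^{(w)} = of (fun b e => −c·w b·Tip b e)` (p314580).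
This module proves, for EVERY `λ : ↥(pbox (fine Lc M′)) → ℝ` and the torus call's `W₀ := fromCols D₂ D₁` (p316503's `hD₁ hD₂` VERBATIM):
* §2 **THE PRODUCT RULE (★)**: `diagonal (λ∘base) * fromCols D₂ D₁ + diagonal (Dλ) * Tip = fromCols D₂ D₁ * C₁(λ)` — columnwise `λ(base)·Dφ + (Dλ)·φ(tip) = D(λφ)`
  for the modes `φ = δ_s` (fine residual sites) and `φ = 1_{block t}` (small-block indicators at coarse residual sites), with `λ·1_{block t}` re-expanded in the
  modes (`= λ̄(t)·1_{block t} + Σ_{s ∈ block t, non-root} (λ(s) − λ̄(t))·δ_s`, `λ̄(t) = λ` AT THE SMALL-BLOCK ROOT — leaf-02's `λ̄`) — the PARAMETER TRANSPORT GENERATOR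
  `C₁(λ)` («multiplication by `λ` in the gauge-mode basis») DISPLAYED by a defining equation as the block lower-triangular matrix
  `fromBlocks (diagonal λ̄) 0 (of (fun s t => (λ s − λ̄ t)·[block s = t])) (diagonal (λ∘val))` on `Res′ ⊕ Res`
  (`torus_productRule_fine`, `torus_productRule_coarse`, **`torus_productRule`**);
* §3 **`torus_j1`**: with `X := −(c • diagonal (λ∘base))` the (B) call's letter `j1` holds EXACTLY with `W₁ := W₁^{(h)}`, **`W′₁ := W₁^{(h + Dλ)}`** (the generator
  jet along the GAUGE-SHIFTED direction — the same shift leaf-02 found for the composite averaging jet, `𝔔′₁ := 𝔔₁^{(h+Dλ)}`) and `C₁ := c • C₁(λ)`, for ANY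
  bond weight `h`; `weightedJet_eq` bridges leaf-02's `Σ_b w b • (row-b literal)` form to the closed form; **`torus_uC_exp`**: if the dictionary takes the
  one-parameter group `C := (1, c•C₁(λ), (c•C₁(λ))²)` (`φ ↦ e^{ucλ}φ` on the parameters) then `uC` IS `ExponentialTransportJets.secondVar_expJet` (p318511).
NOT HERE: `j2` (needs the second generator jet `W₂^{(h)}` ∕ leaf-02's `c2`, not in the tree; prediction `W′₂ := W₂^{(h+Dλ)}`, `C₂ := (c•C₁)²` by (★) twice),
what `λ` is for the literal (the difference of the two charts' tree-gauge functions — the dictionary's), the dead-row letter `p1 : P·W′₁ = 0` (⟺ `h + Dλ`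
vanishes on the big-comb bonds: `NestedStepLawTransportedDeadRows.torus_p_of_vanish_on_bigComb` p319750 on the row-ultralocal literal), any estimate.

HONEST DEPENDENCY (page 1, mandatory): continuum YM on T⁴ ⇐ BetaPertH ∧ nine spine estimates (0/9 proved); BetaPertH ⇐ (D1) ∧ (D4) ∧ CAP+tail;
G-an2-4 gates asym, D1 and NE2/3/4.  HONEST FRAMING (cell contract, verbatim): «discharging `BetaPertH` makes Bałaban's UV stability UNCONDITIONAL —
a real constructive-QFT result; it is NOT the continuum limit and NOT the Clay problem.»  ABSOLUTE RULE (cell charter, verbatim): «No internally-minted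
statement may enter as a cited fact. Every hypothesis is either kernel-proved in this package or a verbatim quotation of a PUBLISHED theorem with page
reference. The manuscript(s) under audit are NOT citable for their own disputed steps — they are the thing under adjudication; programme-internal
(2001/route/tribunal) claims are never citable.»  [folklore] the product rule for lattice gradients on OUR typed torus objects (`tgrad`, `tgradBlock`, `tdelta`,
`Res`); no `def`, no `def … : Prop`, nothing cited, 0 sorry; 0 estimates; 0∕4 row-D1 binders; NOT the dictionary, NOT (T-ID), NOT SDF, NOT D1, NOT BetaPertH,
NOT continuum, NOT Clay.  «not in print; our bookkeeping».
Provenance: D1 formalisation swarm LEAF PROVER 06, unit b2b-balaban-beta-d1-formalise-leaf-06 gen 18, 2026-08-22 (INTENT 4, journal l.40481).  No existing file touched.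
-/

noncomputable section

open scoped BigOperators

namespace Summit.QuantumFields.BalabanUV.Beta.FP.TorusGeneratorIntertwining

open Finset Matrix
open Literature.MathematicalPhysics.QuantumFieldTheory.Balaban1983to89
open Literature.MathematicalPhysics.QuantumFieldTheory.Balaban1983to89.Beta
open Literature.MathematicalPhysics.QuantumFieldTheory.LatticeForm (quo)
open B5Prop11Plancherel (fine)
open B6Lemma24Torus (pbox mem_pbox)
open AffineAveraging (Site box toSite unitVec)
open OneStepResolventKernel (Fib)
open Summit.QuantumFields.BalabanUV.Beta.D1BFx.LogDetSecondVariation (secondVar)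
open Summit.QuantumFields.BalabanUV.Beta.FP.KernelPeriodisationFib (Idx)
open Summit.QuantumFields.BalabanUV.Beta.FP.TorusCombForest (rootOf)
open Summit.QuantumFields.BalabanUV.Beta.FP.TorusCombRows (Res)
open Summit.QuantumFields.BalabanUV.Beta.FP.TorusCombNestedBasis (quo_mem_pbox)
open Summit.QuantumFields.BalabanUV.Beta.FP.TorusGaugeCovariance (tdelta tgrad tgrad_inl tdelta_of_mem)
open Summit.QuantumFields.BalabanUV.Beta.FP.TorusGaugeCovariancePairing (wrapPt wrapPt_of_mem tdelta_eq_ite_wrapPt sum_tdelta_mul)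
open Summit.QuantumFields.BalabanUV.Beta.FP.TorusGaugeCovarianceCoarse (tgradBlock tgradBlock_inl tdelta_quo_wrapPt)
open Summit.QuantumFields.BalabanUV.Beta.FP.ExponentialTransportJets (secondVar_expJet)
open Summit.QuantumFields.BalabanUV.Beta.FP.CompositeWardLetters (fromCols_add)

variable {d : ℕ}

/-! ## §1 Readings: the lattice gradient of a site function against the `tgrad` columns; roots; residual sums -/

section Readings

variable (M : Fin (d + 1) → ℕ) [∀ μ, NeZero (M μ)]

/-- [folklore] **`Σ_s tgrad M (y, inl l) s · λ s = λ(wrap (y + e_l)) − λ(y)`** — the lattice gradient of the site function `λ` along the bond `(y, l)`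
(the tip read through the box representative `wrapPt`). -/
theorem sum_tgrad_mul_eq (y : ↥(pbox M)) (l : Fin (d + 1)) (lam : ↥(pbox M) → ℝ) :
    ∑ s : ↥(pbox M), tgrad M (y, Sum.inl l) s * lam s = lam (wrapPt M ((y : Site (d + 1)) + unitVec l)) - lam y := by
  simp only [tgrad_inl, sub_mul, Finset.sum_sub_distrib, sum_tdelta_mul, wrapPt_of_mem]

omit [∀ μ, NeZero (M μ)] in
/-- [folklore] the comb root of a site in closed form: `rootOf ρ N x = N • quo N x + ρ`. -/
theorem rootOf_eq_smul_quo_add (ρ : Site (d + 1)) (N : ℕ) (x : Site (d + 1)) : rootOf ρ N x = (N : ℤ) • quo N x + ρ := by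
  funext i
  simp only [rootOf, quo, Pi.add_apply, Pi.smul_apply, smul_eq_mul]

omit [∀ μ, NeZero (M μ)] in
/-- [folklore] **A SUM OVER THE RESIDUAL PARAMETERS IS THE SUM OVER THE BOX when the summand vanishes at the comb roots.** -/
theorem sum_res_eq_sum_box {ρ : Site (d + 1)} {N : ℕ} (φ : ↥(pbox M) → ℝ)
    (h0 : ∀ x : ↥(pbox M), (x : Site (d + 1)) = rootOf ρ N (x : Site (d + 1)) → φ x = 0) :
    ∑ s : Res ρ N M, φ s.1 = ∑ x : ↥(pbox M), φ x := by
  classical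
  unfold Res
  rw [← Finset.sum_subtype (Finset.univ.filter fun x : ↥(pbox M) => (x : Site (d + 1)) ≠ rootOf ρ N (x : Site (d + 1)))
    (by intro x; simp) φ, Finset.sum_filter]
  refine Finset.sum_congr rfl fun x _ => ?_
  by_cases h : (x : Site (d + 1)) ≠ rootOf ρ N (x : Site (d + 1))
  · rw [if_pos h]
  · rw [if_neg h, h0 x (not_not.mp h)]

end Readings

/-! ## §2 THE PRODUCT RULE (★): the gauge-mode span of the torus call is closed under multiplication by a site function -/

section ProductRule

variable (M' : Fin (d + 1) → ℕ) [∀ μ, NeZero (M' μ)] {Lc : ℕ} [NeZero Lc] {r r' : Fin (d + 1) → ℕ}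

/-- [folklore] **(★), FINE COLUMNS**: for the fine residual modes `δ_s` (the torus call's `D₁`, `hD₁` VERBATIM) and any site function `λ`,
`λ(base)·D₁ + diagonal(Dλ)·Tip_fine = D₁·diagonal(λ∘val)` — `λ(base b)·(δ_{tip b = s} − δ_{base b = s}) + (λ(tip b) − λ(base b))·δ_{tip b = s} = λ(s)·(δ_{tip b = s} − δ_{base b = s})`. -/
theorem torus_productRule_fine (lam : ↥(pbox (fine Lc M')) → ℝ)
    {D₁ : Matrix (↥(pbox (fine Lc M')) × Fin (d + 1)) (Res (toSite r) Lc (fine Lc M')) ℝ}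
    (hD₁ : D₁ = (tgrad (fine Lc M')).submatrix (fun b : ↥(pbox (fine Lc M')) × Fin (d + 1) => ((b.1, Sum.inl b.2) : Idx (fine Lc M') (Fib d)))
        (Subtype.val : Res (toSite r) Lc (fine Lc M') → ↥(pbox (fine Lc M')))) :
    Matrix.diagonal (fun b : ↥(pbox (fine Lc M')) × Fin (d + 1) => lam b.1) * D₁
        + Matrix.diagonal (fun b : ↥(pbox (fine Lc M')) × Fin (d + 1) => ∑ s, tgrad (fine Lc M') (b.1, Sum.inl b.2) s * lam s)
          * Matrix.of (fun (b : ↥(pbox (fine Lc M')) × Fin (d + 1)) (s : Res (toSite r) Lc (fine Lc M')) =>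
              tdelta (fine Lc M') ((b.1 : Site (d + 1)) + unitVec b.2) s.1)
      = D₁ * Matrix.diagonal (fun s : Res (toSite r) Lc (fine Lc M') => lam s.1) := by
  have hD₁e : ∀ (b : ↥(pbox (fine Lc M')) × Fin (d + 1)) (s : Res (toSite r) Lc (fine Lc M')),
      D₁ b s = tdelta (fine Lc M') ((b.1 : Site (d + 1)) + unitVec b.2) s.1 - tdelta (fine Lc M') (b.1 : Site (d + 1)) s.1 := by
    intro b s; rw [hD₁]; rfl
  ext b s
  simp only [Matrix.add_apply, Matrix.diagonal_mul, Matrix.mul_diagonal, Matrix.of_apply, hD₁e, sum_tgrad_mul_eq, tdelta_eq_ite_wrapPt, wrapPt_of_mem]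
  by_cases h1 : wrapPt (fine Lc M') ((b.1 : Site (d + 1)) + unitVec b.2) = s.1
  · by_cases h2 : b.1 = s.1
    · rw [if_pos h1, if_pos h2, h1, h2]; ring
    · rw [if_pos h1, if_neg h2, h1]; ring
  · by_cases h2 : b.1 = s.1
    · rw [if_neg h1, if_pos h2, h2]; ring
    · rw [if_neg h1, if_neg h2]; ring

/-- [folklore] **(★), COARSE COLUMNS**: for the small-block indicator modes `1_{block t}` (the torus call's `D₂`, `hD₂` VERBATIM; `t` a coarse residual site)
and any site function `λ`, `λ(base)·D₂ + diagonal(Dλ)·Tip_coarse = D₂·diagonal(λ̄) + D₁·(of fun s t => (λ s − λ̄ t)·[block s = t])` with `λ̄ t := λ` at the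
small-block root `Lc•t + toSite r` — `λ·1_{block t} = λ̄(t)·1_{block t} + Σ_{s ∈ block t, non-root}(λ(s) − λ̄(t))·δ_s`, differentiated. -/
theorem torus_productRule_coarse (lam : ↥(pbox (fine Lc M')) → ℝ)
    {D₁ : Matrix (↥(pbox (fine Lc M')) × Fin (d + 1)) (Res (toSite r) Lc (fine Lc M')) ℝ}
    {D₂ : Matrix (↥(pbox (fine Lc M')) × Fin (d + 1)) (Res (toSite r') Lc M') ℝ}
    (hD₁ : D₁ = (tgrad (fine Lc M')).submatrix (fun b : ↥(pbox (fine Lc M')) × Fin (d + 1) => ((b.1, Sum.inl b.2) : Idx (fine Lc M') (Fib d)))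
        (Subtype.val : Res (toSite r) Lc (fine Lc M') → ↥(pbox (fine Lc M'))))
    (hD₂ : D₂ = (tgradBlock M' Lc).submatrix (fun b : ↥(pbox (fine Lc M')) × Fin (d + 1) => ((b.1, Sum.inl b.2) : Idx (fine Lc M') (Fib d)))
        (Subtype.val : Res (toSite r') Lc M' → ↥(pbox M'))) :
    Matrix.diagonal (fun b : ↥(pbox (fine Lc M')) × Fin (d + 1) => lam b.1) * D₂
        + Matrix.diagonal (fun b : ↥(pbox (fine Lc M')) × Fin (d + 1) => ∑ s, tgrad (fine Lc M') (b.1, Sum.inl b.2) s * lam s)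
          * Matrix.of (fun (b : ↥(pbox (fine Lc M')) × Fin (d + 1)) (t : Res (toSite r') Lc M') =>
              tdelta M' (quo Lc ((b.1 : Site (d + 1)) + unitVec b.2)) t.1)
      = D₂ * Matrix.diagonal (fun t : Res (toSite r') Lc M' =>
            ∑ s, tdelta (fine Lc M') ((Lc : ℤ) • ((t.1 : ↥(pbox M')) : Site (d + 1)) + toSite r) s * lam s)
        + D₁ * Matrix.of (fun (s : Res (toSite r) Lc (fine Lc M')) (t : Res (toSite r') Lc M') =>
            (lam s.1 - ∑ s', tdelta (fine Lc M') ((Lc : ℤ) • ((t.1 : ↥(pbox M')) : Site (d + 1)) + toSite r) s' * lam s')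
              * tdelta M' (quo Lc ((s.1 : ↥(pbox (fine Lc M'))) : Site (d + 1))) t.1) := by
  have hLc : 0 < Lc := Nat.pos_of_ne_zero (NeZero.ne Lc)
  have hD₁e : ∀ (b : ↥(pbox (fine Lc M')) × Fin (d + 1)) (s : Res (toSite r) Lc (fine Lc M')),
      D₁ b s = tgrad (fine Lc M') (b.1, Sum.inl b.2) s.1 := by
    intro b s; rw [hD₁]; rfl
  have hD₂e : ∀ (b : ↥(pbox (fine Lc M')) × Fin (d + 1)) (t : Res (toSite r') Lc M'),
      D₂ b t = tdelta M' (quo Lc ((b.1 : Site (d + 1)) + unitVec b.2)) t.1 - tdelta M' (quo Lc (b.1 : Site (d + 1))) t.1 := by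
    intro b t; rw [hD₂]; rfl
  ext b t
  -- the residual sum re-extended over the box: the summand vanishes at the small-block roots
  have hres : ∑ s : Res (toSite r) Lc (fine Lc M'), tgrad (fine Lc M') (b.1, Sum.inl b.2) s.1
        * ((lam s.1 - ∑ s', tdelta (fine Lc M') ((Lc : ℤ) • ((t.1 : ↥(pbox M')) : Site (d + 1)) + toSite r) s' * lam s')
          * tdelta M' (quo Lc ((s.1 : ↥(pbox (fine Lc M'))) : Site (d + 1))) t.1)
      = ∑ x : ↥(pbox (fine Lc M')), tgrad (fine Lc M') (b.1, Sum.inl b.2) x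
        * ((lam x - ∑ s', tdelta (fine Lc M') ((Lc : ℤ) • ((t.1 : ↥(pbox M')) : Site (d + 1)) + toSite r) s' * lam s')
          * tdelta M' (quo Lc (x : Site (d + 1))) t.1) := by
    refine sum_res_eq_sum_box (fine Lc M') (fun x => tgrad (fine Lc M') (b.1, Sum.inl b.2) x
        * ((lam x - ∑ s', tdelta (fine Lc M') ((Lc : ℤ) • ((t.1 : ↥(pbox M')) : Site (d + 1)) + toSite r) s' * lam s')
          * tdelta M' (quo Lc (x : Site (d + 1))) t.1)) fun x hx => ?_
    -- at a root `x = Lc • quo x + toSite r`: either the block is `t` (then `λ̄ = λ x`) or the indicator vanishes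
    have hxq : (x : Site (d + 1)) = (Lc : ℤ) • quo Lc (x : Site (d + 1)) + toSite r := by
      rw [← rootOf_eq_smul_quo_add]; exact hx
    have hqmem : quo Lc (x : Site (d + 1)) ∈ pbox M' := quo_mem_pbox hLc x.2
    rw [tdelta_eq_ite_wrapPt]
    by_cases hq : wrapPt M' (quo Lc (x : Site (d + 1))) = t.1
    · have hq' : quo Lc (x : Site (d + 1)) = ((t.1 : ↥(pbox M')) : Site (d + 1)) := by
        rw [← hq, TorusGaugeCovariancePairing.wrapPt_coe, B6Lemma24Torus.wrap_eq_self hqmem]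
      have hbar : ∑ s', tdelta (fine Lc M') ((Lc : ℤ) • ((t.1 : ↥(pbox M')) : Site (d + 1)) + toSite r) s' * lam s' = lam x := by
        rw [← hq', ← hxq, sum_tdelta_mul, wrapPt_of_mem]
      rw [hbar, sub_self, zero_mul, mul_zero]
    · rw [if_neg hq, mul_zero, mul_zero]
  simp only [Matrix.add_apply, Matrix.diagonal_mul, Matrix.mul_diagonal]
  rw [Matrix.mul_apply]
  simp only [hD₁e, hD₂e, Matrix.of_apply]
  rw [hres]
  simp only [tgrad_inl, sub_mul, Finset.sum_sub_distrib, sum_tdelta_mul, wrapPt_of_mem]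
  rw [← tdelta_quo_wrapPt M' Lc ((b.1 : Site (d + 1)) + unitVec b.2) t.1]
  ring

/-- [folklore] **THE PRODUCT RULE (★) FOR THE TORUS CALL's GENERATOR `W₀ = fromCols D₂ D₁`**: for every site function `λ`,
`diagonal(λ∘base) · W₀ + diagonal(Dλ) · Tip = W₀ · C₁(λ)` with the PARAMETER TRANSPORT GENERATOR `C₁(λ)` («multiplication by `λ` in the gauge-mode basis»)
DISPLAYED by its defining equation `hC₁` — block lower-triangular on `Res′ ⊕ Res`: `diagonal λ̄` (coarse), `diagonal (λ∘val)` (fine), the coarse-to-fine block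
`(λ s − λ̄ t)·[block s = t]`, zero fine-to-coarse block.  `Tip` = the support of leaf-02's generator first jet (`tdelta` at the TIP of the bond: coarse class ∕ fine site). -/
theorem torus_productRule (lam : ↥(pbox (fine Lc M')) → ℝ)
    {D₁ : Matrix (↥(pbox (fine Lc M')) × Fin (d + 1)) (Res (toSite r) Lc (fine Lc M')) ℝ}
    {D₂ : Matrix (↥(pbox (fine Lc M')) × Fin (d + 1)) (Res (toSite r') Lc M') ℝ}
    (hD₁ : D₁ = (tgrad (fine Lc M')).submatrix (fun b : ↥(pbox (fine Lc M')) × Fin (d + 1) => ((b.1, Sum.inl b.2) : Idx (fine Lc M') (Fib d)))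
        (Subtype.val : Res (toSite r) Lc (fine Lc M') → ↥(pbox (fine Lc M'))))
    (hD₂ : D₂ = (tgradBlock M' Lc).submatrix (fun b : ↥(pbox (fine Lc M')) × Fin (d + 1) => ((b.1, Sum.inl b.2) : Idx (fine Lc M') (Fib d)))
        (Subtype.val : Res (toSite r') Lc M' → ↥(pbox M')))
    {C₁ : Matrix (Res (toSite r') Lc M' ⊕ Res (toSite r) Lc (fine Lc M')) (Res (toSite r') Lc M' ⊕ Res (toSite r) Lc (fine Lc M')) ℝ}
    (hC₁ : C₁ = Matrix.fromBlocks
        (Matrix.diagonal fun t : Res (toSite r') Lc M' =>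
          ∑ s, tdelta (fine Lc M') ((Lc : ℤ) • ((t.1 : ↥(pbox M')) : Site (d + 1)) + toSite r) s * lam s)
        (0 : Matrix (Res (toSite r') Lc M') (Res (toSite r) Lc (fine Lc M')) ℝ)
        (Matrix.of fun (s : Res (toSite r) Lc (fine Lc M')) (t : Res (toSite r') Lc M') =>
          (lam s.1 - ∑ s', tdelta (fine Lc M') ((Lc : ℤ) • ((t.1 : ↥(pbox M')) : Site (d + 1)) + toSite r) s' * lam s')
            * tdelta M' (quo Lc ((s.1 : ↥(pbox (fine Lc M'))) : Site (d + 1))) t.1)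
        (Matrix.diagonal fun s : Res (toSite r) Lc (fine Lc M') => lam s.1)) :
    Matrix.diagonal (fun b : ↥(pbox (fine Lc M')) × Fin (d + 1) => lam b.1) * fromCols D₂ D₁
        + Matrix.diagonal (fun b : ↥(pbox (fine Lc M')) × Fin (d + 1) => ∑ s, tgrad (fine Lc M') (b.1, Sum.inl b.2) s * lam s)
          * Matrix.of (fun (b : ↥(pbox (fine Lc M')) × Fin (d + 1)) (e : Res (toSite r') Lc M' ⊕ Res (toSite r) Lc (fine Lc M')) =>
              Sum.elim (fun t : Res (toSite r') Lc M' => tdelta M' (quo Lc ((b.1 : Site (d + 1)) + unitVec b.2)) t.1)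
                (fun s : Res (toSite r) Lc (fine Lc M') => tdelta (fine Lc M') ((b.1 : Site (d + 1)) + unitVec b.2) s.1) e)
      = fromCols D₂ D₁ * C₁ := by
  have hTip : (Matrix.of fun (b : ↥(pbox (fine Lc M')) × Fin (d + 1)) (e : Res (toSite r') Lc M' ⊕ Res (toSite r) Lc (fine Lc M')) =>
        Sum.elim (fun t : Res (toSite r') Lc M' => tdelta M' (quo Lc ((b.1 : Site (d + 1)) + unitVec b.2)) t.1)
          (fun s : Res (toSite r) Lc (fine Lc M') => tdelta (fine Lc M') ((b.1 : Site (d + 1)) + unitVec b.2) s.1) e)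
      = fromCols
          (Matrix.of fun (b : ↥(pbox (fine Lc M')) × Fin (d + 1)) (t : Res (toSite r') Lc M') => tdelta M' (quo Lc ((b.1 : Site (d + 1)) + unitVec b.2)) t.1)
          (Matrix.of fun (b : ↥(pbox (fine Lc M')) × Fin (d + 1)) (s : Res (toSite r) Lc (fine Lc M')) =>
            tdelta (fine Lc M') ((b.1 : Site (d + 1)) + unitVec b.2) s.1) := by
    ext b (t | s) <;> rfl
  rw [hTip, hC₁, Matrix.fromCols_mul_fromBlocks, Matrix.mul_fromCols, Matrix.mul_fromCols, fromCols_add, Matrix.mul_zero, zero_add,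
    torus_productRule_coarse M' lam hD₁ hD₂, torus_productRule_fine M' lam hD₁]

end ProductRule

/-! ## §3 The (B) call's letter `j1` EXACTLY, and `uC` for the exponential parameter transport -/

section Letters

variable (M' : Fin (d + 1) → ℕ) [∀ μ, NeZero (M' μ)] {Lc : ℕ} [NeZero Lc] {r r' : Fin (d + 1) → ℕ}

omit [∀ μ, NeZero (M' μ)] [NeZero Lc] in
/-- [folklore] **leaf-02's weighted generator jet in closed form**: `Σ_b w b • (row-b literal) = of (fun b e => −c·w b·Tip b e)` (p314580's `W₁`∕`D̄₁` currency). -/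
theorem weightedJet_eq {σ : Type*} (c : ℝ) (w : ↥(pbox (fine Lc M')) × Fin (d + 1) → ℝ)
    (Tip : ↥(pbox (fine Lc M')) × Fin (d + 1) → σ → ℝ) :
    (∑ b : ↥(pbox (fine Lc M')) × Fin (d + 1), w b •
        Matrix.of (fun (b' : ↥(pbox (fine Lc M')) × Fin (d + 1)) (e : σ) => if b' = b then -(c * Tip b e) else 0))
      = Matrix.of fun (b : ↥(pbox (fine Lc M')) × Fin (d + 1)) (e : σ) => -(c * w b * Tip b e) := by
  ext b e
  simp only [Matrix.sum_apply, Matrix.smul_apply, Matrix.of_apply, smul_eq_mul, mul_ite, mul_zero, Finset.sum_ite_eq, Finset.mem_univ,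
    if_true]
  ring

/-- [folklore] **`j1` OF `NestedStepLawTorusTransported` HOLDS EXACTLY AT THE RECORD, WITH `W′₁ := W₁^{(h+Dλ)}`.**  With the torus call's `hD₁ hD₂`, leaf-02's
field transport `X := −(c • diagonal (λ∘base))`, the generator first jets in closed form `W₁^{(w)} = of (fun b e => −(c·w b·Tip b e))` and the parameter
transport `c • C₁(λ)` (`hC₁` as in `torus_productRule`): for EVERY weight `h` and EVERY site function `λ`,
`−X * fromCols D₂ D₁ + W₁^{(h)} = W₁^{(h + Dλ)} + fromCols D₂ D₁ * (c • C₁)`, `(Dλ) b = Σ_s tgrad (fine Lc M′) (b.1, inl b.2) s · λ s`. -/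
theorem torus_j1 (lam : ↥(pbox (fine Lc M')) → ℝ) (c : ℝ) (h : ↥(pbox (fine Lc M')) × Fin (d + 1) → ℝ)
    {D₁ : Matrix (↥(pbox (fine Lc M')) × Fin (d + 1)) (Res (toSite r) Lc (fine Lc M')) ℝ}
    {D₂ : Matrix (↥(pbox (fine Lc M')) × Fin (d + 1)) (Res (toSite r') Lc M') ℝ}
    (hD₁ : D₁ = (tgrad (fine Lc M')).submatrix (fun b : ↥(pbox (fine Lc M')) × Fin (d + 1) => ((b.1, Sum.inl b.2) : Idx (fine Lc M') (Fib d)))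
        (Subtype.val : Res (toSite r) Lc (fine Lc M') → ↥(pbox (fine Lc M'))))
    (hD₂ : D₂ = (tgradBlock M' Lc).submatrix (fun b : ↥(pbox (fine Lc M')) × Fin (d + 1) => ((b.1, Sum.inl b.2) : Idx (fine Lc M') (Fib d)))
        (Subtype.val : Res (toSite r') Lc M' → ↥(pbox M')))
    {C₁ : Matrix (Res (toSite r') Lc M' ⊕ Res (toSite r) Lc (fine Lc M')) (Res (toSite r') Lc M' ⊕ Res (toSite r) Lc (fine Lc M')) ℝ}
    (hC₁ : C₁ = Matrix.fromBlocks
        (Matrix.diagonal fun t : Res (toSite r') Lc M' =>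
          ∑ s, tdelta (fine Lc M') ((Lc : ℤ) • ((t.1 : ↥(pbox M')) : Site (d + 1)) + toSite r) s * lam s)
        (0 : Matrix (Res (toSite r') Lc M') (Res (toSite r) Lc (fine Lc M')) ℝ)
        (Matrix.of fun (s : Res (toSite r) Lc (fine Lc M')) (t : Res (toSite r') Lc M') =>
          (lam s.1 - ∑ s', tdelta (fine Lc M') ((Lc : ℤ) • ((t.1 : ↥(pbox M')) : Site (d + 1)) + toSite r) s' * lam s')
            * tdelta M' (quo Lc ((s.1 : ↥(pbox (fine Lc M'))) : Site (d + 1))) t.1)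
        (Matrix.diagonal fun s : Res (toSite r) Lc (fine Lc M') => lam s.1))
    {X : Matrix (↥(pbox (fine Lc M')) × Fin (d + 1)) (↥(pbox (fine Lc M')) × Fin (d + 1)) ℝ}
    (hX : X = -(c • Matrix.diagonal (fun b : ↥(pbox (fine Lc M')) × Fin (d + 1) => lam b.1)))
    {W₁ W₁' : Matrix (↥(pbox (fine Lc M')) × Fin (d + 1)) (Res (toSite r') Lc M' ⊕ Res (toSite r) Lc (fine Lc M')) ℝ}
    (hW₁ : W₁ = Matrix.of fun (b : ↥(pbox (fine Lc M')) × Fin (d + 1)) (e : Res (toSite r') Lc M' ⊕ Res (toSite r) Lc (fine Lc M')) =>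
        -(c * h b * Sum.elim (fun t : Res (toSite r') Lc M' => tdelta M' (quo Lc ((b.1 : Site (d + 1)) + unitVec b.2)) t.1)
          (fun s : Res (toSite r) Lc (fine Lc M') => tdelta (fine Lc M') ((b.1 : Site (d + 1)) + unitVec b.2) s.1) e))
    (hW₁' : W₁' = Matrix.of fun (b : ↥(pbox (fine Lc M')) × Fin (d + 1)) (e : Res (toSite r') Lc M' ⊕ Res (toSite r) Lc (fine Lc M')) =>
        -(c * (h b + ∑ s, tgrad (fine Lc M') (b.1, Sum.inl b.2) s * lam s)
          * Sum.elim (fun t : Res (toSite r') Lc M' => tdelta M' (quo Lc ((b.1 : Site (d + 1)) + unitVec b.2)) t.1)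
            (fun s : Res (toSite r) Lc (fine Lc M') => tdelta (fine Lc M') ((b.1 : Site (d + 1)) + unitVec b.2) s.1) e)) :
    -X * fromCols D₂ D₁ + W₁ = W₁' + fromCols D₂ D₁ * (c • C₁) := by
  have key := torus_productRule M' lam hD₁ hD₂ hC₁
  -- scale (★) by `c` and split the shifted jet
  have hsplit : W₁' = W₁ + -(c • (Matrix.diagonal (fun b : ↥(pbox (fine Lc M')) × Fin (d + 1) => ∑ s, tgrad (fine Lc M') (b.1, Sum.inl b.2) s * lam s)
      * Matrix.of (fun (b : ↥(pbox (fine Lc M')) × Fin (d + 1)) (e : Res (toSite r') Lc M' ⊕ Res (toSite r) Lc (fine Lc M')) =>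
          Sum.elim (fun t : Res (toSite r') Lc M' => tdelta M' (quo Lc ((b.1 : Site (d + 1)) + unitVec b.2)) t.1)
            (fun s : Res (toSite r) Lc (fine Lc M') => tdelta (fine Lc M') ((b.1 : Site (d + 1)) + unitVec b.2) s.1) e))) := by
    rw [hW₁, hW₁']
    ext b e
    simp only [Matrix.add_apply, Matrix.neg_apply, Matrix.smul_apply, Matrix.diagonal_mul, Matrix.of_apply, smul_eq_mul]
    ring
  rw [hsplit, hX, neg_neg, Matrix.smul_mul, Matrix.mul_smul, ← key, smul_add]
  abel

/-- [folklore] **`uC` FOR THE EXPONENTIAL PARAMETER TRANSPORT**: if the dictionary takes the one-parameter group generated by `c • C₁(λ)` on the parameters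
(`C := (1, c•C₁, (c•C₁)·(c•C₁))` — `φ ↦ e^{ucλ}·φ` in the gauge-mode basis), the letter `uC : secondVar 1 C₁ C₂ = 0` of the (B) call IS
`ExponentialTransportJets.secondVar_expJet` (p318511). -/
theorem torus_uC_exp {ι : Type*} [Fintype ι] [DecidableEq ι] (c : ℝ) (C₁ : Matrix ι ι ℝ) :
    secondVar (1 : Matrix ι ι ℝ) (c • C₁) (c • C₁ * (c • C₁)) = 0 :=
  secondVar_expJet (c • C₁)

end Letters

end Summit.QuantumFields.BalabanUV.Beta.FP.TorusGeneratorIntertwining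

end
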